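import Summits.BirchSwinnertonDyer.BirchSwinnertonDyer.Theorems.ErratumRoadFiveEulerHalfNotRamLevelLoweringCut
import HarnessLib

/-!
# Route `ErratumRoadFive` (K2, `p ≥ 5`), crux `NonSurjCorner` (item stmt-BirchSwinnertonDyer-19065) and its child `NonSurjCornerTwinMuAn`
# (item 19948): THE SERRE-LEVEL DOOR — every residual class of the (T4′) corner is a WEIGHT-TWO NEWFORM CLASS OF LEVEL DIVIDING THE
# ADDITIVE CONDUCTOR (cell `bsd-stepL`, WIDTH-LEVER lane B `bsd-stepL-corner5-p2` g10; `--supports stmt-BirchSwinnertonDyer-19948 --as helper`)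

WHAT. The corner hypotheses `¬ (ram)` (every multiplicative `ℓ ≠ p` is a `p`-carrier, i.e. `E[p]` is unramified at `ℓ`) and `p ∣ ord_p(Δ_min)`
(`E[p]` is peu ramifié at the multiplicative prime `p`) say exactly that Serre's invariants of `ρ̄ = E[p] ⊗ 𝔽̄_p` are `k(ρ̄) = 2` and
`N(ρ̄) ∣ N_E` with `N(ρ̄)` supported on the primes of ADDITIVE reduction of `E` (Serre 1987 §4.1; for `p ≥ 5` in fact `N(ρ̄) = N_add(E)`,
Kraus). Ribet–Diamond level lowering then produces a newform `f` of weight `2` and level `M ∣ N(ρ̄)` with `ρ̄ ≅ ρ̄_f`. This is the POSITIVE form of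
the `birth`-line lead's level-lowering cut `EulerHalfLevelLoweringCut.not_dvd_ordp_of_primePowerAdditive_of_not_ram` (bsd-idea-9 g3 ∕ er5-p1 g1),
which is the case where such an `f` cannot exist; proof = its Steps 1–5 verbatim, returning the newform instead of a contradiction.

* §1 `exists_newform_two_of_not_ram_of_dvd` — the door (Γ₁(M), `M ∣ N_E`, every prime of `M` is an additive prime of `E`, `p ∤ M`), and
  `exists_newform0_two_of_not_ram_of_dvd` — its `Γ₀(M)` form when `p ∤ φ(M)` (trivial nebentypus).
* §2 `false_of_not_ram_of_dvd_of_levelOracle` — the GENERAL genus-zero cut: if every level `M ∣ N_E` supported on the additive primes has `p ∤ φ(M)`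
  and `S₂(Γ₀(M)) = 0`, the locus is empty (the lead's three cuts `M ∣ 16, 9, 25` are instances; not restated).
* §3 the corner instances BY THE ROUTE'S BINDERS: `NonSurjTwin.exists_newform_two` (19948's population: `ClassX11a`, `p ∈ {5, 7}`, `p ∣ ord_p Δ_min`)
  and `NonSurjCorner.exists_newform_two` (19065's: `ClassX11b ∧ ¬(ram) ∧ p ∣ ord_p Δ_min`).

WHY (lane B, 19948 = one `μ_an = 0` certificate per mod-`p` congruence class, kernel door p621412): the residual classes of the corner are thereby
indexed by triples (level `M` = an additive conductor, newform `g` of level `M`, prime `℘ ∣ p` of `ℚ(a_n(g))`) — FINITELY MANY PER LEVEL — which is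
the bookkeeping of the lane's Serre-level census (HOME/corner5/g10). HONEST FRAMING: theorems CONDITIONAL on the three printed inputs, by name and
not asserted: modularity `exists_isNewformOf`, Diamond's refined level lowering `diamond1995_refinedSerre`, the Ogg–Saito identity
`WeierstrassCurve.artinConductorExponent_tate_eq_conductorExponent_of_isElliptic`; no `sorry`, no new definition, no new named fact; item 19065 ∕ 19948
are NOT closed; BSD is proved for no curve; no summit statement is touched.
[cite: Ribet1990, Thm. 1.1] [cite: Diamond1995RefinedSerre, Thm. 1.1] [cite: Serre1987, §2.8 Prop. 4, §4.1 (4.1.12)] [cite: Kraus1997, p. 1143 (N(ρ̄) = N_E away from the carriers)]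
-/

set_option autoImplicit false
set_option linter.dupNamespace false

noncomputable section

open scoped Classical MatrixGroups ModularForm NumberField

open WeierstrassCurve Literature.NumberTheory Literature.NumberTheory.GaloisRepresentations
  Literature.NumberTheory.EllipticCurves Literature.NumberTheory.EllipticCurves.ModularForms
  Rat.HeightOneSpectrum IsDedekindDomain IsDedekindDomain.HeightOneSpectrum
  Literature.NumberTheory.Automorphic Literature.NumberTheory.Automorphic.BCDT
  Literature.NumberTheory.DiophantineGeometry Literature.NumberTheory.EllipticCurves.Rank1Residual
  Literature.NumberTheory.GaloisRepresentations.ModPGaloisRep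
  Literature.NumberTheory.GaloisRepresentations.IsNonarchimedeanLocalField
  Literature.NumberTheory.EllipticCurves.SkinnerUrban2014 ValuativeRel CongruenceSubgroup Polynomial
  Summit.BirchSwinnertonDyer.Rank1Residual Summit.BirchSwinnertonDyer.Rank1Residual.X11b
  Summit.BirchSwinnertonDyer.BirchSwinnertonDyer.Theorems.EulerHalfLevelLoweringCut

namespace Summit.BirchSwinnertonDyer.BirchSwinnertonDyer.Theorems.NonSurjCornerSerreLevel

/-! ### §1 The Serre-level door -/

/-- **THE SERRE-LEVEL DOOR (Γ₁ form).** `p ≥ 5` multiplicative for `E`, `E[p]` irreducible, NO (ram) prime (every multiplicative `ℓ ≠ p` is a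
`p`-carrier) and `p ∣ ord_p(Δ_min)` ⟹ for the framed model `ρ` of `E[p]` and `ρ̄' = ρ ⊗ 𝔽̄_p`: there is a level `M ∣ N_E`, NOT divisible by `p`,
all of whose prime factors are primes of ADDITIVE reduction of `E` (neither good nor multiplicative), and a newform `f ∈ S₂(Γ₁(M))` with
`ρ̄' ≅ ρ̄_f` (`IsGaloisRepOfNewform1Int f ιf {q ∣ M p} ρ̄'`). Proof: `ρ̄'` is irreducible, odd (det = cyclotomic) and modular (`E` is); its Serre weight
at the place above `p` is `2` (multiplicative, peu ramifié: `serreWeight_eq_two_of_hasMultiplicativeReductionAt_of_dvd`); Diamond's refined level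
lowering gives `f` of weight `2` and level `M ∣ N(ρ̄')`; `N(ρ̄') ∣ N_E` (Ogg–Saito) and no good prime, no carrier and not `p` divides `N(ρ̄')`.
[cite: Ribet1990, Thm. 1.1] [cite: Diamond1995RefinedSerre, Thm. 1.1] [cite: Serre1987, §2.8 Prop. 4, §4.1 (4.1.12)] -/
theorem exists_newform_two_of_not_ram_of_dvd
    (hmod : exists_isNewformOf) (hLL : diamond1995_refinedSerre)
    (hOS : ∀ (W : WeierstrassCurve ℚ) (ℓ : ℕ) [Fact ℓ.Prime],
      W.artinConductorExponent_tate_eq_conductorExponent_of_isElliptic ℓ)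
    (W : WeierstrassCurve ℚ) [W.IsElliptic] [W.IsGloballyMinimal]
    (p : ℕ) [Fact p.Prime] (hp5 : 5 ≤ p) (hmultp : Mult W p) (hirr : Irr W p) (hnram : ¬ Ram W p)
    (hpeu : p ∣ padicValInt p W.minimalDiscriminantInt)
    [TopologicalSpace (AlgebraicClosure (ZMod p))] [DiscreteTopology (AlgebraicClosure (ZMod p))]
    {ρ : ModPGaloisRep ℚ (ZMod p) 2} (hρ : W.IsTorsionGaloisRep p ρ) :
    ∃ (M : ℕ) (_ : NeZero M), M ∣ W.conductorNorm ℤ ∧ ¬ p ∣ M ∧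
      (∀ (q : ℕ) [Fact q.Prime], q ∣ M → ¬ W.HasGoodReductionAtPrime q ∧ ¬ W.HasMultiplicativeReductionAtPrime q) ∧
      ∃ (f : CuspForm (Gamma1 M) 2)
        (ιf : coeffCharIntegers f →+* AlgebraicClosure (ZMod p)),
        IsNewform1 f ∧ IsGaloisRepOfNewform1Int f ιf {q | q ∣ M * p}
          (FramedRep.baseChange (algebraMap (ZMod p) (AlgebraicClosure (ZMod p)))
            continuous_of_discreteTopology ρ) := by
  classical
  have hp : p.Prime := Fact.out
  have hp2 : p ≠ 2 := by omega
  have hodd : Odd p := hp.odd_of_ne_two hp2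
  -- `ord_u Δ_min = v_{ℓ}(Δ_min)` at every place `u` of `ℤ`
  have hordZ : ∀ u : HeightOneSpectrum ℤ,
      W.ordMinimalDiscriminant u = padicValInt (natGenerator u) W.minimalDiscriminantInt := by
    intro u
    rw [← W.factorization_minimalDiscriminantNorm_holds u,
      minimalDiscriminantNorm_int_eq_natAbs_minimalDiscriminantInt_holds W,
      Nat.factorization_def _ (show (natGenerator u).Prime from (primesEquiv u).2)]
    rfl
  -- `¬ Ram`: at every multiplicative place `u ∤ p` of `ℤ`, `p ∣ ord_u Δ_min`
  have hunr : ∀ u : HeightOneSpectrum ℤ, natGenerator u ≠ p → W.HasMultiplicativeReductionAt u →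
      p ∣ W.ordMinimalDiscriminant u := by
    intro u hup hmu
    by_contra hdiv
    apply hnram
    refine ⟨natGenerator u, ⟨(primesEquiv u).2⟩, hup,
      (hasMultiplicativeReductionAtPrime_primesEquiv_iff_hasMultiplicativeReductionAt W u).mpr hmu,
      ?_⟩
    rwa [hordZ u] at hdiv
  /- Step 1. `ρ̄' = ρ̄ ⊗ 𝔽̄_p`: irreducible and odd. -/
  haveI : NeZero ((p : ℕ) : ℚ) := ⟨by exact_mod_cast hp.ne_zero⟩
  set j : ZMod p →+* AlgebraicClosure (ZMod p) := algebraMap (ZMod p) (AlgebraicClosure (ZMod p))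
    with hj
  set ρ' : ModPGaloisRep ℚ (AlgebraicClosure (ZMod p)) 2 :=
    FramedRep.baseChange j continuous_of_discreteTopology ρ with hρ'
  have habs := isAbsolutelyIrreducible_of_hasIrreducibleModPGaloisRep W hp2 hirr hρ
  have hirr' : ρ'.toGaloisRep.IsIrreducible := by
    rw [← ModPGaloisRep.isIrreducible_iff_toGaloisRep]
    exact habs.isIrreducible_baseChange (AlgebraicClosure (ZMod p)) j _
  have hodd' : FramedGaloisRep.IsOdd ρ' :=
    (ModPGaloisRep.isOdd_of_det_eq_modPCyclotomicCharacterZMod ρ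
      (W.det_eq_modPCyclotomicCharacter_of_isTorsionGaloisRep_holds p ρ hρ)).baseChange j _
  /- Step 2. `ρ̄` and `ρ̄'` are modular, `E` being modular (`hmod`). -/
  haveI : NeZero (W.conductorNorm ℤ) := ⟨(conductorNorm_pos_holds W).ne'⟩
  have hWmod : BCDT.IsModular W := exists_isNewformOf_iff.mp hmod W
  have hρmod : ModPGaloisRep.IsModular ρ := hWmod.isModular_of_isTorsionGaloisRep'' hρ
  have hρ'mod : ModPGaloisRep.IsModular ρ' := hρmod.baseChange_algebraicClosure
  /- Step 3. The canonical local datum at the place `v` above `p`; the weight is `2` (multiplicative, peu ramifié). -/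
  obtain ⟨v, hv⟩ : ∃ v : HeightOneSpectrum (𝓞 ℚ), primesEquiv v = ⟨p, hp⟩ :=
    ⟨(primesEquiv (R := 𝓞 ℚ)).symm ⟨p, hp⟩, Equiv.apply_symm_apply _ _⟩
  have hpv' : (p : 𝓞 ℚ) ∈ v.asIdeal := (natCast_mem_asIdeal_iff_primesEquiv_eq v hp).mpr (by rw [hv])
  have hvs : v = (primesEquiv (R := 𝓞 ℚ)).symm ⟨p, hp⟩ := by
    rw [Equiv.eq_symm_apply]; exact hv
  set uZ : HeightOneSpectrum ℤ := (primesEquiv (R := ℤ)).symm ⟨p, hp⟩ with huZ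
  have huZp : natGenerator uZ = p := Rat.natGenerator_primesEquiv_symm ⟨p, hp⟩
  have hpe : (primesEquiv uZ : Nat.Primes) = ⟨p, hp⟩ := Equiv.apply_symm_apply _ _
  have hmultZ : W.HasMultiplicativeReductionAt uZ := by
    have h := hasMultiplicativeReductionAtPrime_primesEquiv_iff_hasMultiplicativeReductionAt W uZ
    rw [hpe] at h
    exact h.mp hmultp
  have hmultv : W.HasMultiplicativeReductionAt v := by
    rw [hvs]; exact hasMultiplicativeReductionAt_of_int W ⟨p, hp⟩ hmultZ
  have hpordv : p ∣ W.ordMinimalDiscriminant v := by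
    rw [hvs, ordMinimalDiscriminant_eq_of_int, ← huZ, hordZ uZ, huZp]; exact hpeu
  set loc : LocalRestrictionAt p ρ' :=
    { F := v.adicCompletion ℚ
      residueFieldCard_eq := residueFieldCard_adicCompletion_eq_of_natCast_mem hpv'
      irreducible_natCast := irreducible_natCast_valuativeInteger_adicCompletion_of_natCast_mem hpv'
      rep := FramedGaloisRep.restrictField (v.adicCompletion ℚ) ρ'
      rep_eq_restrictField := rfl } with hloc
  obtain ⟨ι⟩ := nonempty_ringHom_residue (k := AlgebraicClosure (ZMod p)) p (v.adicCompletion ℚ)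
    (residueFieldCard_adicCompletion_eq_of_natCast_mem hpv')
  have hw : (serreWeight p ρ' loc ι : ℤ) = 2 := by
    have h2 : serreWeight p ρ' loc ι = 2 :=
      serreWeight_eq_two_of_hasMultiplicativeReductionAt_of_dvd W p hp2 v hpv' hmultv hpordv hρ
        (AlgebraicClosure (ZMod p)) j ι
    rw [h2]; rfl
  /- Step 4. Level lowering: `ρ̄'` arises from a newform `f` of weight `2` and level `M ∣ N(ρ̄')`. -/
  obtain ⟨M, hMz, hMN, f, ιf, hf, hgal⟩ :=
    hLL p hodd (AlgebraicClosure (ZMod p)) ρ' hirr' hodd' hρ'mod loc ι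
  revert hgal hf ιf f
  rw [hw]
  intro f ιf hf hgal
  /- Step 5. `N(ρ̄') ∣ N_E` (Ogg–Saito); a prime `q ∣ N(ρ̄')` is neither `p`, nor good, nor multiplicative (a carrier, by `¬ Ram`). -/
  have hlevN : serreLevel p ρ' ∣ W.conductorNorm ℤ :=
    serreLevel_baseChange_dvd_conductorNorm_of_tate hOS W p ρ hρ (AlgebraicClosure (ZMod p)) j
  have hprime : ∀ (q : ℕ) [Fact q.Prime], q ∣ serreLevel p ρ' →
      q ≠ p ∧ ¬ W.HasGoodReductionAtPrime q ∧ ¬ W.HasMultiplicativeReductionAtPrime q := by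
    intro q hqF hqN
    have hq : q.Prime := hqF.out
    have hqp : q ≠ p := by
      rintro rfl
      exact not_dvd_serreLevel q ρ' hqN
    obtain ⟨u, hu⟩ : ∃ u : HeightOneSpectrum ℤ, natGenerator u = q :=
      ⟨(primesEquiv (R := ℤ)).symm ⟨q, hq⟩, Rat.natGenerator_primesEquiv_symm ⟨q, hq⟩⟩
    subst hu
    refine ⟨hqp, fun hgood ↦ ?_, fun hmult ↦ ?_⟩
    · have hgu : W.HasGoodReductionAt u :=
        (hasGoodReductionAtPrime_primesEquiv_iff_hasGoodReductionAt W u).mp hgood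
      exact not_dvd_serreLevel_baseChange_of_hasGoodReductionAt_int W p hρ j _ u hqp hgu hqN
    · have hmu : W.HasMultiplicativeReductionAt u :=
        (hasMultiplicativeReductionAtPrime_primesEquiv_iff_hasMultiplicativeReductionAt W u).mp hmult
      exact not_dvd_serreLevel_baseChange_of_hasMultiplicativeReductionAt_of_dvd_int W p hρ j _ u
        hqp hmu (hunr u hqp hmu) hqN
  haveI : NeZero M := hMz
  refine ⟨M, hMz, hMN.trans hlevN, fun hpM ↦ (hprime p (hpM.trans hMN)).1 rfl,
    fun q _ hqM ↦ (hprime q (hqM.trans hMN)).2, f, ιf, hf, hgal⟩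

/-- **THE SERRE-LEVEL DOOR (Γ₀ form).** As `exists_newform_two_of_not_ram_of_dvd`, and if moreover `p ∤ φ(M)` for every level `M ∣ N_E` supported
on the additive primes of `E` (e.g. `N_add(E)` has no prime factor `≡ 1 (mod p)` and `p² ∤ N_add(E)`), the nebentypus of `f` is trivial and `f` is
(the `Γ₁`-lift of) a newform on `Γ₀(M)`: `ρ̄ ⊗ 𝔽̄_p ≅ ρ̄_g`, `g ∈ S₂(Γ₀(M))` new. (Nebentypus: `det ρ̄_f = ε̄_f χ̄ = det ρ̄' = χ̄` forces `ε̄_f = 1`, and a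
character of `(ℤ/M)ˣ` with trivial reduction mod `p` is trivial once `p ∤ φ(M)` — the tree's `nebentypus_eq_one_of_isGaloisRepOfNewform1Int_of_not_dvd_totient`.)
[cite: Ribet1990, Thm. 1.1] [cite: Diamond1995RefinedSerre, Thm. 1.1] [cite: Carayol1989, Prop. 3 (nebentypus)] -/
theorem exists_newform0_two_of_not_ram_of_dvd
    (hmod : exists_isNewformOf) (hLL : diamond1995_refinedSerre)
    (hOS : ∀ (W : WeierstrassCurve ℚ) (ℓ : ℕ) [Fact ℓ.Prime],
      W.artinConductorExponent_tate_eq_conductorExponent_of_isElliptic ℓ)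
    (W : WeierstrassCurve ℚ) [W.IsElliptic] [W.IsGloballyMinimal]
    (p : ℕ) [Fact p.Prime] (hp5 : 5 ≤ p) (hmultp : Mult W p) (hirr : Irr W p) (hnram : ¬ Ram W p)
    (hpeu : p ∣ padicValInt p W.minimalDiscriminantInt)
    (htot : ∀ M : ℕ, M ∣ W.conductorNorm ℤ →
      (∀ (q : ℕ) [Fact q.Prime], q ∣ M → ¬ W.HasGoodReductionAtPrime q ∧ ¬ W.HasMultiplicativeReductionAtPrime q) →
      ¬ p ∣ Nat.totient M)
    [TopologicalSpace (AlgebraicClosure (ZMod p))] [DiscreteTopology (AlgebraicClosure (ZMod p))]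
    {ρ : ModPGaloisRep ℚ (ZMod p) 2} (hρ : W.IsTorsionGaloisRep p ρ) :
    ∃ (M : ℕ) (_ : NeZero M), M ∣ W.conductorNorm ℤ ∧ ¬ p ∣ M ∧
      (∀ (q : ℕ) [Fact q.Prime], q ∣ M → ¬ W.HasGoodReductionAtPrime q ∧ ¬ W.HasMultiplicativeReductionAtPrime q) ∧
      ∃ (f : CuspForm (Gamma1 M) 2)
        (ιf : coeffCharIntegers f →+* AlgebraicClosure (ZMod p)) (g : CuspForm (Gamma0 M) 2),
        IsNewform1 f ∧ nebentypus f = 1 ∧ IsNewform0 g ∧ (⇑g : UpperHalfPlane → ℂ) = ⇑f ∧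
        IsGaloisRepOfNewform1Int f ιf {q | q ∣ M * p}
          (FramedRep.baseChange (algebraMap (ZMod p) (AlgebraicClosure (ZMod p)))
            continuous_of_discreteTopology ρ) := by
  classical
  obtain ⟨M, hMz, hMN, hpM, hadd, f, ιf, hf, hgal⟩ :=
    exists_newform_two_of_not_ram_of_dvd hmod hLL hOS W p hp5 hmultp hirr hnram hpeu hρ
  haveI : NeZero M := hMz
  haveI : NeZero (W.conductorNorm ℤ) := ⟨(conductorNorm_pos_holds W).ne'⟩
  have hε : nebentypus f = 1 :=
    nebentypus_eq_one_of_isGaloisRepOfNewform1Int_of_not_dvd_totient W hρ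
      (algebraMap (ZMod p) (AlgebraicClosure (ZMod p))) (htot M hMN hadd) ιf hgal (W.conductorNorm ℤ)
      fun q _ hqB hqd ↦ absurd (Nat.le_of_dvd (conductorNorm_pos_holds W) hqd) (not_le.mpr hqB)
  obtain ⟨g, hg, hgf⟩ := exists_isNewform0_coe_eq_of_nebentypus_eq_one hf hε
  exact ⟨M, hMz, hMN, hpM, hadd, f, ιf, g, hf, hε, hg, hgf, hgal⟩

/-! ### §2 The general genus-zero cut -/

/-- **THE GENERAL LEVEL-LOWERING CUT.** On the locus of §1 (`p ≥ 5` multiplicative, `E[p]` irreducible, `¬ (ram)`, `p ∣ ord_p Δ_min`): if EVERY level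
`M ∣ N_E` supported on the additive primes of `E` has `p ∤ φ(M)` and carries no weight-`2` cusp form on `Γ₀(M)`, we reach a contradiction. The
`birth`-line cuts (`M ∣ 16`, `M ∣ 9`, `M ∣ 25`, semistable `M = 1`) are the instances where the additive conductor is a genus-zero level; this is the
statement for an arbitrary additive support. [cite: Ribet1990, Thm. 1.1] [cite: Diamond1995RefinedSerre, Thm. 1.1] [cite: DiamondShurman2005, Thm. 3.5.1] -/
theorem false_of_not_ram_of_dvd_of_levelOracle
    (hmod : exists_isNewformOf) (hLL : diamond1995_refinedSerre)
    (hOS : ∀ (W : WeierstrassCurve ℚ) (ℓ : ℕ) [Fact ℓ.Prime],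
      W.artinConductorExponent_tate_eq_conductorExponent_of_isElliptic ℓ)
    (W : WeierstrassCurve ℚ) [W.IsElliptic] [W.IsGloballyMinimal]
    (p : ℕ) [Fact p.Prime] (hp5 : 5 ≤ p) (hmultp : Mult W p) (hirr : Irr W p) (hnram : ¬ Ram W p)
    (hpeu : p ∣ padicValInt p W.minimalDiscriminantInt)
    (horacle : ∀ (M : ℕ) [NeZero M], M ∣ W.conductorNorm ℤ →
      (∀ (q : ℕ) [Fact q.Prime], q ∣ M → ¬ W.HasGoodReductionAtPrime q ∧ ¬ W.HasMultiplicativeReductionAtPrime q) →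
      ¬ p ∣ Nat.totient M ∧ ∀ f : CuspForm (Gamma0 M) 2, f = 0) : False := by
  classical
  have hp : p.Prime := Fact.out
  haveI : NeZero ((p : ℕ) : ℚ) := ⟨by exact_mod_cast hp.ne_zero⟩
  letI : TopologicalSpace (AlgebraicClosure (ZMod p)) := ⊥
  haveI : DiscreteTopology (AlgebraicClosure (ZMod p)) := ⟨rfl⟩
  obtain ⟨ρ, hρ⟩ := W.exists_isTorsionGaloisRep p
  obtain ⟨M, hMz, hMN, -, hadd, f, ιf, g, hf, -, hg, hgf, -⟩ :=
    exists_newform0_two_of_not_ram_of_dvd hmod hLL hOS W p hp5 hmultp hirr hnram hpeu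
      (fun M hMN hadd ↦ by
        haveI : NeZero M := ⟨fun h0 ↦ by
          subst h0
          exact (conductorNorm_pos_holds W).ne' (zero_dvd_iff.mp hMN)⟩
        exact (horacle M hMN hadd).1) hρ
  haveI : NeZero M := hMz
  exact hg.ne_zero ((horacle M hMN hadd).2 g)

/-! ### §3 The corner instances (the route's binders) -/

/-- **19948's population enters the door.** For a leaf twin `Wd ∈ ClassX11a` (`r_an = 0`, `p ∥ N` odd, `E[p]` irreducible, NO (ram) prime) at
`p ∈ {5, 7}` with `p ∣ ord_p Δ_min`: `Wd[p] ⊗ 𝔽̄_p ≅ ρ̄_f` for a newform `f ∈ S₂(Γ₁(M))`, `M ∣ N_{Wd}` supported on the additive primes of `Wd`, `p ∤ M`.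
So the mod-`p` congruence class of every member of `Theses.ErratumRoadFive.NonSurjCornerTwinMuAn`'s population — the unit in which the lane's
`μ_an = 0` certificate is counted (`NonSurjTwin.twinMuAn_of_congruentCertificates`, p621412) — is a weight-two newform class of level an additive
conductor: finitely many classes per level. [cite: Ribet1990, Thm. 1.1] [cite: Diamond1995RefinedSerre, Thm. 1.1] -/
theorem NonSurjTwin.exists_newform_two
    (hmod : exists_isNewformOf) (hLL : diamond1995_refinedSerre)
    (hOS : ∀ (W : WeierstrassCurve ℚ) (ℓ : ℕ) [Fact ℓ.Prime],
      W.artinConductorExponent_tate_eq_conductorExponent_of_isElliptic ℓ)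
    (Wd : WeierstrassCurve ℚ) [Wd.IsElliptic] [Wd.IsGloballyMinimal] (p : ℕ) [Fact p.Prime]
    (hX : ClassX11a Wd p) (hp : p = 5 ∨ p = 7) (hpeu : p ∣ padicValInt p Wd.minimalDiscriminantInt)
    [TopologicalSpace (AlgebraicClosure (ZMod p))] [DiscreteTopology (AlgebraicClosure (ZMod p))]
    {ρ : ModPGaloisRep ℚ (ZMod p) 2} (hρ : Wd.IsTorsionGaloisRep p ρ) :
    ∃ (M : ℕ) (_ : NeZero M), M ∣ Wd.conductorNorm ℤ ∧ ¬ p ∣ M ∧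
      (∀ (q : ℕ) [Fact q.Prime], q ∣ M → ¬ Wd.HasGoodReductionAtPrime q ∧ ¬ Wd.HasMultiplicativeReductionAtPrime q) ∧
      ∃ (f : CuspForm (Gamma1 M) 2)
        (ιf : coeffCharIntegers f →+* AlgebraicClosure (ZMod p)),
        IsNewform1 f ∧ IsGaloisRepOfNewform1Int f ιf {q | q ∣ M * p}
          (FramedRep.baseChange (algebraMap (ZMod p) (AlgebraicClosure (ZMod p)))
            continuous_of_discreteTopology ρ) :=
  exists_newform_two_of_not_ram_of_dvd hmod hLL hOS Wd p (by rcases hp with rfl | rfl <;> norm_num)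
    hX.2.2.1 hX.2.2.2.1 hX.2.2.2.2 hpeu hρ

/-- **19065's population enters the door.** For a corner pair `W ∈ ClassX11b` (`r_an = 1`, `p ∥ N` odd, `E[p]` irreducible) with NO (ram) prime and
`p ∣ ord_p Δ_min` (`p ≥ 5`; the item has `p ∈ {5, 7}` and `ρ̄` not onto, neither of which is needed here): `W[p] ⊗ 𝔽̄_p ≅ ρ̄_f` for a newform
`f ∈ S₂(Γ₁(M))`, `M ∣ N_W` supported on the additive primes, `p ∤ M`. [cite: Ribet1990, Thm. 1.1] [cite: Diamond1995RefinedSerre, Thm. 1.1] -/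
theorem NonSurjCorner.exists_newform_two
    (hmod : exists_isNewformOf) (hLL : diamond1995_refinedSerre)
    (hOS : ∀ (W : WeierstrassCurve ℚ) (ℓ : ℕ) [Fact ℓ.Prime],
      W.artinConductorExponent_tate_eq_conductorExponent_of_isElliptic ℓ)
    (W : WeierstrassCurve ℚ) [W.IsElliptic] [W.IsGloballyMinimal] (p : ℕ) [Fact p.Prime]
    (hX : ClassX11b W p) (hp5 : 5 ≤ p) (hpeu : p ∣ padicValInt p W.minimalDiscriminantInt) (hnram : ¬ Ram W p)
    [TopologicalSpace (AlgebraicClosure (ZMod p))] [DiscreteTopology (AlgebraicClosure (ZMod p))]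
    {ρ : ModPGaloisRep ℚ (ZMod p) 2} (hρ : W.IsTorsionGaloisRep p ρ) :
    ∃ (M : ℕ) (_ : NeZero M), M ∣ W.conductorNorm ℤ ∧ ¬ p ∣ M ∧
      (∀ (q : ℕ) [Fact q.Prime], q ∣ M → ¬ W.HasGoodReductionAtPrime q ∧ ¬ W.HasMultiplicativeReductionAtPrime q) ∧
      ∃ (f : CuspForm (Gamma1 M) 2)
        (ιf : coeffCharIntegers f →+* AlgebraicClosure (ZMod p)),
        IsNewform1 f ∧ IsGaloisRepOfNewform1Int f ιf {q | q ∣ M * p}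
          (FramedRep.baseChange (algebraMap (ZMod p) (AlgebraicClosure (ZMod p)))
            continuous_of_discreteTopology ρ) :=
  exists_newform_two_of_not_ram_of_dvd hmod hLL hOS W p hp5 hX.2.2.1 hX.2.2.2 hnram hpeu hρ

end Summit.BirchSwinnertonDyer.BirchSwinnertonDyer.Theorems.NonSurjCornerSerreLevel

end
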